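import Summits.ResolutionOfSingularities.ResolutionOfSingularities.Theorems.EquisingularLiftEquisingularLiftNatPlaneCurveUnobs
import Summits.ResolutionOfSingularities.ResolutionOfSingularities.Theorems.EquisingularLiftEquisingularLiftNatDirStepUnobsHostChange
import Literature.AlgebraicGeometry.Motives.HypersurfaceChartAlgebra
import Literature.AlgebraicGeometry.Resolution.PlaneNearPointLemmas
import HarnessLib

/-!
# [OURS · L1 W4.5(b) · EL♮(3) · WIDTH TABLE D4, row D4-5 (iso-w2)] LINES IN THE FRESH PLANE ARE UNOBSTRUCTED:
# `DirStepUnobs ℙ²_k univ _ V₊(a₀X₀ + a₁X₁ + a₂X₂) _` (`𝒩 = 𝒪(1)`) and the NEST-line certificate through the model door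

Crux chain w45b (cell `res-hironaka`, LADDER-RESOLUTION rung L, slot W4.5(b)), child EL♮(3) = stmt-ResolutionOfSingularities-20148; desk
res-L1-w45b-plan-1 WIDTH TABLE D4 «HOSTED NOSE + PREFIX NEST» v0 (STATUS 2026-08-28T18:46:00Z), row D4-5: «iso-w2 the NEST-line-in-fresh-plane
certificate via ✓ p656762 + a line-in-ℙ² `DirStepUnobs` (𝒩 = 𝒪(1))».  res-L1-w45b-iso-w2 g2 (WIDTH seat D-0157 DOOR 1), `--supports
stmt-ResolutionOfSingularities-20148 --as helper`.  OURS; NOT a statement of any manuscript; AI-written, weaker than expert review.  No `sorry`;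
standard axioms; DEF-FREE.

WHAT (namespace `…Sections.PlaneCurveSplit`).  The line is the degree-one case of ✓ `dirStepUnobs_planeCurve` (…NatPlaneCurveUnobs: every plane
curve with a point off it and radical chart equations is unobstructed); what this file adds is the discharge of the two side conditions for a
LINEAR form `ℓ = a₀X₀ + a₁X₁ + a₂X₂` with `a₀ ≠ 0`:
* `dehomogenize_one_line`, `dehomogenize_two_line` — the chart equations `ℓ/X₁ = a₀y₀ + a₁ + a₂y₁`, `ℓ/X₂ = a₀y₀ + a₁y₁ + a₂` in the tree's
  chart coordinates (`ProjectiveSpace.dehomogenize`);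
* `isPrime_span_linear` — `(a₀y₀ + c + b y₁) ⊂ k[y₀,y₁]` is prime for `a₀ ≠ 0` (it is `(y₀ − h(y₁))` up to the unit `a₀`; Literature
  `ker_aeval_vecCons_X`), hence `isRadical_span_chartEqn_line` — the chart equations of the line generate RADICAL ideals;
* **`dirStepUnobs_line`** — `DirStepUnobs ℙ²_k univ _ V₊(ℓ) _` for every field `k` and every `a : Fin 3 → k` with `a 0 ≠ 0`
  (`H¹(ℙ¹, 𝒩_{L/ℙ²}) = H¹(ℙ¹, 𝒪(1)) = 0`, here as the `d = 1` instance of the generic plane-curve certificate);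
* **`dirStepUnobs_nestLine_of_model_iso`** — THE NEST-LINE CERTIFICATE: for a point step `υ` at a closed point `x` (fresh plane
  `E' = υ⁻¹{x}`), a closed `Z ⊆ E'` and ONE isomorphism `e : ℙ²_k ≅ redSub G' E'` carrying the model line `V₊(ℓ)` onto `Z`, the NEST clause
  `DirStepUnobs G' E' _ Z _` holds (✓ (H2) `dirStepUnobs_of_model_iso`, …NatDirStepUnobsHostChange).

Degenerate checks (by type): `a 0 ≠ 0` is load-bearing twice (the point `(1:0:0)` must be off the line for the charts `D₊(X₁)`, `D₊(X₂)` to cover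
it, and `ℓ ≠ 0`); `a 1 = a 2 = 0` (the line `X₀ = 0`) is allowed.  HONEST SCOPE: model-level + the (H2) door; the specimen-side input «fresh plane
≅ ℙ² carrying the model line onto `Z`» stays with the customer; counted 0; EL♮(3) is NOT proved; resolution in characteristic `p` is NOT proved
here (dim 3 is Cossart–Piltant 2008/2009 in print).

References (index only): R. Hartshorne, *Algebraic Geometry* (1977), II Example 3.2.6, III Thm. 5.1 [cite: Hartshorne1977].
-/

set_option linter.dupNamespace false -- mandated namespace `Summit.<Summit>.<Problem>` of this single-conjunct summit

noncomputable section

-- `TopCat.Presheaf`/`Scheme.Modules` are not reducible (as in Mathlib's `AlgebraicGeometry/Modules`).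
set_option backward.isDefEq.respectTransparency false

open CategoryTheory AlgebraicGeometry Opposite TopologicalSpace MvPolynomial HomogeneousLocalization
open Literature.AlgebraicGeometry.Motives Literature.AlgebraicGeometry.Motives.ProjectiveSpace

attribute [local instance] MvPolynomial.gradedAlgebra ProjBaseChange.algebraBase

namespace Summit.ResolutionOfSingularities.ResolutionOfSingularities.Cruxes.EquisingularLiftNat.Sections

namespace PlaneCurveSplit

variable (k : Type) [Field k]

/-! ### Linear forms: the chart equations are prime -/

/-- The linear form `ℓ_a = a₀X₀ + a₁X₁ + a₂X₂` is homogeneous of degree `1`. [folklore] -/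
theorem isHomogeneous_linear (a : Fin 3 → k) :
    (C (a 0) * X 0 + C (a 1) * X 1 + C (a 2) * X 2 : MvPolynomial (Fin 3) k).IsHomogeneous 1 := by
  refine ((isHomogeneous_C_mul_X (a 0) 0).add (isHomogeneous_C_mul_X (a 1) 1)).add (isHomogeneous_C_mul_X (a 2) 2)

/-- The `X₀`-coefficient of `ℓ_a` is `a₀`. [folklore] -/
theorem coeff_single_zero_linear (a : Fin 3 → k) :
    coeff (Finsupp.single 0 1) (C (a 0) * X 0 + C (a 1) * X 1 + C (a 2) * X 2 : MvPolynomial (Fin 3) k) = a 0 := by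
  simp only [coeff_add, coeff_C_mul, coeff_X, Finsupp.single_eq_single_iff]
  simp

/-- The chart equation of the line on `D₊(X₁)`: `ℓ/X₁ = a₀y₀ + a₁ + a₂y₁`. [folklore] -/
theorem dehomogenize_one_linear (a : Fin 3 → k) :
    dehomogenize k (1 : Fin 3) (C (a 0) * X 0 + C (a 1) * X 1 + C (a 2) * X 2 : MvPolynomial (Fin 3) k) =
      C (a 0) * X 0 + C (a 1) + C (a 2) * X 1 := by
  have h0 : (X 0 : MvPolynomial (Fin 3) k) = X ((1 : Fin 3).succAbove 0) := by rw [show (1 : Fin 3).succAbove 0 = 0 from by decide]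
  have h2 : (X 2 : MvPolynomial (Fin 3) k) = X ((1 : Fin 3).succAbove 1) := by rw [show (1 : Fin 3).succAbove 1 = 2 from by decide]
  rw [h0, h2]
  simp only [map_add, map_mul, algHom_C, MvPolynomial.algebraMap_eq, dehomogenize_X_self, dehomogenize_X_succAbove, mul_one]

/-- The chart equation of the line on `D₊(X₂)`: `ℓ/X₂ = a₀y₀ + a₁y₁ + a₂`. [folklore] -/
theorem dehomogenize_two_linear (a : Fin 3 → k) :
    dehomogenize k (2 : Fin 3) (C (a 0) * X 0 + C (a 1) * X 1 + C (a 2) * X 2 : MvPolynomial (Fin 3) k) =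
      C (a 0) * X 0 + C (a 1) * X 1 + C (a 2) := by
  have h0 : (X 0 : MvPolynomial (Fin 3) k) = X ((2 : Fin 3).succAbove 0) := by rw [show (2 : Fin 3).succAbove 0 = 0 from by decide]
  have h1 : (X 1 : MvPolynomial (Fin 3) k) = X ((2 : Fin 3).succAbove 1) := by rw [show (2 : Fin 3).succAbove 1 = 1 from by decide]
  rw [h0, h1]
  simp only [map_add, map_mul, algHom_C, MvPolynomial.algebraMap_eq, dehomogenize_X_self, dehomogenize_X_succAbove, mul_one]

/-- `(a₀y₀ + c + b·y₁) ⊂ k[y₀,y₁]` is a PRIME ideal when `a₀ ≠ 0` (it is `(y₀ − h(y₁))`, `h = −(c + bT)/a₀`, up to the unit `a₀`;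
Literature `ker_aeval_vecCons_X`). [folklore] -/
theorem isPrime_span_linear {a₀ : k} (ha : a₀ ≠ 0) (c b : k) :
    (Ideal.span {(C a₀ * X 0 + C c + C b * X 1 : MvPolynomial (Fin 2) k)}).IsPrime := by
  have hker := Literature.AlgebraicGeometry.Resolution.ker_aeval_vecCons_X k (Polynomial.C (-(c / a₀)) + Polynomial.C (-(b / a₀)) * Polynomial.X)
  have heq : (C a₀ * X 0 + C c + C b * X 1 : MvPolynomial (Fin 2) k) =
      C a₀ * (X 0 - (Polynomial.C (-(c / a₀)) + Polynomial.C (-(b / a₀)) * Polynomial.X).toMvPolynomial 1) := by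
    rw [map_add, map_mul, Polynomial.toMvPolynomial_C, Polynomial.toMvPolynomial_C, Polynomial.toMvPolynomial_X, map_neg, map_neg,
      mul_sub, sub_eq_add_neg, ← mul_neg, neg_add, neg_mul, neg_neg, neg_neg, mul_add, ← mul_assoc, ← map_mul, ← map_mul,
      mul_div_cancel₀ _ ha, mul_div_cancel₀ _ ha, add_assoc]
  have hunit : IsUnit (C a₀ : MvPolynomial (Fin 2) k) := (Ne.isUnit ha).map C
  rw [heq, Ideal.span_singleton_mul_left_unit hunit, ← hker]
  exact RingHom.ker_isPrime _

/-- The chart equations `ℓ/X₁`, `ℓ/X₂` of the line generate RADICAL (indeed prime) ideals of the chart rings. [folklore] -/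
theorem isRadical_span_chartEqn_linear (a : Fin 3 → k) (ha : a 0 ≠ 0) (i : Fin 3) (hi : i = 1 ∨ i = 2) :
    (Ideal.span {SmoothHypersurface.chartEqn (C (a 0) * X 0 + C (a 1) * X 1 + C (a 2) * X 2 : MvPolynomial (Fin 3) k) i
      (isHomogeneous_linear k a)}).IsRadical := by
  have key : ∀ (p : MvPolynomial (Fin 2) k), (Ideal.span {p}).IsPrime → (Ideal.span {toChart k i p}).IsRadical := by
    intro p hp
    have h : Ideal.span {toChart k i p} = Ideal.map (chartAlgEquiv k i).symm (Ideal.span {p}) := by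
      rw [Ideal.map_span, Set.image_singleton]; rfl
    rw [h]
    haveI := hp
    exact (Ideal.map_isPrime_of_equiv (chartAlgEquiv k i).symm (I := Ideal.span {p})).isRadical
  rw [SmoothHypersurface.chartEqn, isLocalizationElem_X]
  rcases hi with rfl | rfl
  · rw [dehomogenize_one_linear]
    exact key _ (isPrime_span_linear k ha (a 1) (a 2))
  · rw [dehomogenize_two_linear]
    have e : (C (a 0) * X 0 + C (a 1) * X 1 + C (a 2) : MvPolynomial (Fin 2) k) = C (a 0) * X 0 + C (a 2) + C (a 1) * X 1 := by ring
    rw [e]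
    exact key _ (isPrime_span_linear k ha (a 2) (a 1))

/-! ### The certificates -/

/-- **LINES ARE UNOBSTRUCTED IN THE PLANE** — `DirStepUnobs ℙ²_k univ _ V₊(a₀X₀ + a₁X₁ + a₂X₂) _` for every field `k` and `a₀ ≠ 0`
(`H¹(ℙ¹, 𝒪(1)) = 0`; the `d = 1` case of ✓ `dirStepUnobs_planeCurve`).  Every line is of this form after a permutation of the coordinates.
[OURS · L1 W4.5b · EL♮(3) · WIDTH TABLE D4 row D4-5 (iso-w2); NOT a statement of the manuscript] -/
theorem dirStepUnobs_line (a : Fin 3 → k) (ha : a 0 ≠ 0) :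
    DirStepUnobs (Proj (homogeneousSubmodule (Fin 3) k)) Set.univ isClosed_univ
      (SmoothHypersurface.zeroLocusClosed (C (a 0) * X 0 + C (a 1) * X 1 + C (a 2) * X 2 : MvPolynomial (Fin 3) k) : Set _)
      (SmoothHypersurface.zeroLocusClosed (C (a 0) * X 0 + C (a 1) * X 1 + C (a 2) * X 2 : MvPolynomial (Fin 3) k)).isClosed :=
  dirStepUnobs_planeCurve (C (a 0) * X 0 + C (a 1) * X 1 + C (a 2) * X 2) (isHomogeneous_linear k a) one_pos
    (by rw [coeff_single_zero_linear]; exact Ne.isUnit ha)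
    (isRadical_span_chartEqn_linear k a ha 1 (Or.inl rfl)) (isRadical_span_chartEqn_linear k a ha 2 (Or.inr rfl))

/-- **THE NEST-LINE CERTIFICATE (door (ii))**: at a point step `υ : G' ⟶ G` (blow-up of the closed point `x`), for a closed `Z` inside the fresh
plane `υ⁻¹{x}` and ONE isomorphism `e : ℙ²_k ≅ redSub G' (υ⁻¹{x})` carrying the model line `V₊(a₀X₀ + a₁X₁ + a₂X₂)` (`a₀ ≠ 0`) onto `Z`, the
NEST clause `DirStepUnobs G' (υ⁻¹{x}) _ Z hZ` holds. (`dirStepUnobs_line` through ✓ (H2) `dirStepUnobs_of_model_iso`; the point-step hypotheses are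
not even needed for the door — only the isomorphism.) [OURS · L1 W4.5b · EL♮(3) · WIDTH TABLE D4 row D4-5 (iso-w2); NOT a statement of the manuscript] -/
theorem dirStepUnobs_nestLine_of_model_iso (a : Fin 3 → k) (ha : a 0 ≠ 0)
    (G' : Scheme.{0}) (E : Set G') (hE : IsClosed E) (Z : Set G') (hZ : IsClosed Z) (hZE : Z ⊆ E)
    (e : Proj (homogeneousSubmodule (Fin 3) k) ≅ redSub G' E hE)
    (he : (e.hom : Proj (homogeneousSubmodule (Fin 3) k) → redSub G' E hE) ''
      (SmoothHypersurface.zeroLocusClosed (C (a 0) * X 0 + C (a 1) * X 1 + C (a 2) * X 2 : MvPolynomial (Fin 3) k) : Set _) =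
      (redSubι G' E hE : redSub G' E hE → G') ⁻¹' Z) :
    DirStepUnobs G' E hE Z hZ :=
  dirStepUnobs_of_model_iso (Proj (homogeneousSubmodule (Fin 3) k)) _ _ (dirStepUnobs_line k a ha) G' E hE Z hZ hZE e he

end PlaneCurveSplit

end Summit.ResolutionOfSingularities.ResolutionOfSingularities.Cruxes.EquisingularLiftNat.Sections

end
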